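import Mathlib
import HarnessLib
import Summits.FinalStateConjecture.FinalStateConjecture.Theses.PhaseMixingCapture
import Literature.Geometry.Lorentzian.KerrSurfaceGravity
import Literature.Geometry.Lorentzian.KerrHawkingField
import Literature.Geometry.Lorentzian.KerrSeparatedPotential
import Literature.Geometry.Lorentzian.KerrTimelikeSpan

/-!
# Sketch — crux-ideate round 1, ideator 1, crux `NearExtremalKappaCapture`
(stmt-FinalStateConjecture-10606, route PhaseMixingCapture)

First lemmas of the three idea cards, typed over existing declarations. Nothing here is an item;
`sorry` is allowed (ideation stage). Each `firstLemma_*` is the first checkable statement of its line.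

* Card `area-excess-ratchet`      — `firstLemma_areaExcess_calibration`, `firstLemma_areaExcess_noParking`,
                                     `areaExcess_surfaceGravity`.
* Card `unit-temperature-front-face` — `firstLemma_hawkingNorm_frontFace` (the blown-up Hawking field
                                     `κ⁻¹ K` has a finite, non-degenerate norm on the front face up to `a = M`).
* Card `polynomial-closure`        — `firstLemma_polynomialBasin` (continuity argument with explicit
                                     threshold `ε ≤ 1/(16 C² K)`), `firstLemma_superradiantMargin_linear`
                                     (DRSR Lemma 6.4.1 margin is exactly linear in `χ = 1 − (a/M)²`).
-/

namespace Summit.FinalStateConjecture.FinalStateConjecture.Cruxes.NearExtremalKappaCapture.Ideator1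

open Literature.Geometry.Lorentzian
open Set Filter Topology

/-! ## Card `area-excess-ratchet` -/

/-- Kerr calibration of the area excess `𝔞(M,a) := A/(8π) − |J| = M r₊ − |a| M` against the
extremality parameter: `M²√χ ≤ 𝔞 ≤ 2 M² √χ`, `χ = 1 − (a/M)²` (so `𝔞 ≍ M³ κ` by
`Kerr.mul_surfaceGravity_mem_Icc`). Exact real algebra: with `s = |a|/M`,
`𝔞/M² = 1 − s + √(1 − s²)` and `√(1−s²) ≤ 1 − s + √(1−s²) ≤ 2√(1−s²)` since `1 − s ≤ √(1−s)√(1+s)`. -/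
theorem firstLemma_areaExcess_calibration {M a : ℝ} (hM : 0 < M) (ha : |a| ≤ M) :
    M ^ 2 * √(1 - (a / M) ^ 2) ≤ M * Kerr.rPlus M a - |a| * M ∧
      M * Kerr.rPlus M a - |a| * M ≤ 2 * M ^ 2 * √(1 - (a / M) ^ 2) := by
  rw [Kerr.sqrt_one_sub_div_sq hM]
  set q := √(M ^ 2 - a ^ 2) with hq
  have hq0 : 0 ≤ q := Real.sqrt_nonneg _
  have hrp : Kerr.rPlus M a = M + q := rfl
  have hsq : a ^ 2 = |a| ^ 2 := (sq_abs a).symm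
  have hMa : 0 ≤ M - |a| := by linarith
  have hle : M - |a| ≤ q := by
    rw [hq]
    apply Real.le_sqrt_of_sq_le
    nlinarith [abs_nonneg a]
  constructor
  · rw [hrp]
    have : M ^ 2 * (q / M) = M * q := by field_simp
    rw [this]
    nlinarith
  · rw [hrp]
    have : 2 * M ^ 2 * (q / M) = 2 * M * q := by field_simp
    rw [this]
    nlinarith [mul_le_mul_of_nonneg_left hle hM.le]

/-- The area excess is comparable to `M³ κ`: `2 M³ κ ≤ 𝔞 ≤ 8 M³ κ` on the closed range `|a| ≤ M`
(from the calibration and `√χ/4 ≤ Mκ ≤ √χ/2`, `Kerr.mul_surfaceGravity_mem_Icc`). -/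
theorem areaExcess_surfaceGravity {M a : ℝ} (hM : 0 < M) (ha : |a| ≤ M) :
    2 * M ^ 3 * Kerr.surfaceGravity M a ≤ M * Kerr.rPlus M a - |a| * M ∧
      M * Kerr.rPlus M a - |a| * M ≤ 8 * M ^ 3 * Kerr.surfaceGravity M a := by
  obtain ⟨h1, h2⟩ := firstLemma_areaExcess_calibration hM ha
  obtain ⟨h3, h4⟩ := Kerr.mul_surfaceGravity_mem_Icc ha hM
  have hM2 : 0 ≤ M ^ 2 := sq_nonneg M
  constructor
  · calc 2 * M ^ 3 * Kerr.surfaceGravity M a = 2 * M ^ 2 * (M * Kerr.surfaceGravity M a) := by ring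
      _ ≤ 2 * M ^ 2 * (√(1 - (a / M) ^ 2) / 2) := by gcongr
      _ = M ^ 2 * √(1 - (a / M) ^ 2) := by ring
      _ ≤ _ := h1
  · calc M * Kerr.rPlus M a - |a| * M ≤ 2 * M ^ 2 * √(1 - (a / M) ^ 2) := h2
      _ = 8 * M ^ 2 * (√(1 - (a / M) ^ 2) / 4) := by ring
      _ ≤ 8 * M ^ 2 * (M * Kerr.surfaceGravity M a) := by gcongr
      _ = 8 * M ^ 3 * Kerr.surfaceGravity M a := by ring

/-- NO PARKING from the ratchet, arithmetic core: if the final hole `(M_f, a_f)` has area excess at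
least HALF the initial Kerr one (in axisymmetry it cannot drop at all: area theorem + Komar `J`
conserved; in general it drops by at most the radiated angular momentum) and `M_f ≤ 2M` (indeed
`M_f ≤ E_ADM ≈ M`), then its extremality parameter is comparable: `χ_f ≥ χ/256`. -/
theorem firstLemma_areaExcess_noParking {M a Mf af : ℝ} (hM : 0 < M) (ha : |a| < M)
    (hMf : 0 < Mf) (hMfle : Mf ≤ 2 * M) (haf : |af| < Mf)
    (h : (M * Kerr.rPlus M a - |a| * M) / 2 ≤ Mf * Kerr.rPlus Mf af - |af| * Mf) :
    (1 - (a / M) ^ 2) / 256 ≤ 1 - (af / Mf) ^ 2 := by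
  obtain ⟨h1, _⟩ := firstLemma_areaExcess_calibration hM ha.le
  obtain ⟨_, h4⟩ := firstLemma_areaExcess_calibration hMf haf.le
  set X := √(1 - (a / M) ^ 2) with hX
  set Y := √(1 - (af / Mf) ^ 2) with hY
  have hχ0 : 0 ≤ 1 - (a / M) ^ 2 := by
    rw [sub_nonneg, div_pow, div_le_one (by positivity), sq_le_sq, abs_of_pos hM]
    exact ha.le
  have hχf0 : 0 ≤ 1 - (af / Mf) ^ 2 := by
    rw [sub_nonneg, div_pow, div_le_one (by positivity), sq_le_sq, abs_of_pos hMf]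
    exact haf.le
  have hX0 : 0 ≤ X := Real.sqrt_nonneg _
  have hY0 : 0 ≤ Y := Real.sqrt_nonneg _
  -- chain: M² X / 2 ≤ 𝔞/2 ≤ 𝔞_f ≤ 2 Mf² Y ≤ 8 M² Y
  have hchain : M ^ 2 * X / 2 ≤ 2 * Mf ^ 2 * Y := by linarith
  have hMf2 : Mf ^ 2 ≤ 4 * M ^ 2 := by nlinarith
  have hXY : X ≤ 16 * Y := by
    have : M ^ 2 * X ≤ M ^ 2 * (16 * Y) := by nlinarith [mul_nonneg (sq_nonneg M) hY0]
    exact le_of_mul_le_mul_left this (by positivity)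
  have hXsq : X ^ 2 = 1 - (a / M) ^ 2 := by rw [hX, Real.sq_sqrt hχ0]
  have hYsq : Y ^ 2 = 1 - (af / Mf) ^ 2 := by rw [hY, Real.sq_sqrt hχf0]
  rw [← hXsq, ← hYsq]
  nlinarith [mul_le_mul hXY hXY hX0 (by positivity)]

/-! ## Card `unit-temperature-front-face` -/

/-- The Kerr–Schild point with `t* = 0`, `φ* = 0`, Boyer–Lindquist-type radius
`r = r₊ + x (r₊ − r₋)` (blown-up throat depth `x ≥ 0`) and `cos θ = c`:
`(0, r sin θ, a sin θ, r cos θ)` (for `φ* = 0`: `x + iy = (r + ia) e^{iφ*} sin θ`, `z = r cos θ`). -/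
noncomputable def throatPoint (M a x c : ℝ) : E4 :=
  E4.ofTimeSpace 0 ((EuclideanSpace.equiv (Fin 3) ℝ).symm
    ![(Kerr.rPlus M a + x * (Kerr.rPlus M a - Kerr.rMinus M a)) * √(1 - c ^ 2),
      a * √(1 - c ^ 2),
      (Kerr.rPlus M a + x * (Kerr.rPlus M a - Kerr.rMinus M a)) * c])

/-- **Unit-temperature front face.** At fixed blown-up depth `x` the Hawking Killing field
`K = T + ω₊ Φ` has `g(K, K) = κ² · F(a/M, x, cos θ)` with `F` extending CONTINUOUSLY to the extremal
endpoint `a/M = 1`, and the limit is non-degenerate: `F(1, x, c) < 0` for small `x > 0` (the rescaled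
generator `∂_t̂ = κ⁻¹ K` is timelike just outside a NON-degenerate Killing horizon of the near-NHEK
front face). Mechanism: `K` is null on `𝓗⁺`, `∂_r g(K,K)|_{r₊} = −2κ g(K, ∂_r) = −2κ Σ₊/(r₊² + a²)`
and `r − r₊ = x (r₊ − r₋) = 2κ (r₊² + a²) x`, so both Taylor terms are `O(κ²)` at fixed `x`. -/
theorem firstLemma_hawkingNorm_frontFace {M a₁ X : ℝ} (hM : 0 < M) (ha₁ : 0 < a₁) (ha₁' : a₁ < 1)
    (hX : 0 < X) :
    ∃ F : ℝ → ℝ → ℝ → ℝ,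
      ContinuousOn (fun p : ℝ × ℝ × ℝ ↦ F p.1 p.2.1 p.2.2) (Icc a₁ 1 ×ˢ Icc 0 X ×ˢ Icc (-1) 1) ∧
      (∀ s ∈ Ico a₁ 1, ∀ x ∈ Icc 0 X, ∀ c ∈ Icc (-1 : ℝ) 1,
        Kerr.bilin M (s * M) (throatPoint M (s * M) x c)
            (Kerr.hawkingVector M (s * M) (throatPoint M (s * M) x c))
            (Kerr.hawkingVector M (s * M) (throatPoint M (s * M) x c)) =
          Kerr.surfaceGravity M (s * M) ^ 2 * F s x c) ∧
      ∃ X₀ > (0 : ℝ), ∀ c ∈ Icc (-1 : ℝ) 1, ∀ x ∈ Ioc 0 X₀, F 1 x c < 0 := by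
  sorry

/-! ## Card `polynomial-closure` -/

/-- **Polynomial basin law** (the continuity argument with its threshold made explicit): if a
continuous `f` on `[0, T]` starts below `C ε` and improves from `f ≤ 4Cε` to `f ≤ Cε + C K f²`,
then `ε ≤ 1/(16 C² K)` forces `f ≤ 2 C ε` throughout (`ε > 0`; for `ε = 0` the statement is false,
e.g. `f t = t`). The threshold is POLYNOMIAL in the linear constant `C` and the nonlinearity constant
`K`: polynomial in ⇒ polynomial out. PROVED (real induction). -/
theorem firstLemma_polynomialBasin {C K ε T : ℝ} (hC : 1 ≤ C) (hK : 0 < K) (hε : 0 < ε)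
    (hsmall : ε ≤ 1 / (16 * C ^ 2 * K)) (f : ℝ → ℝ) (hf : ContinuousOn f (Icc 0 T))
    (h0 : f 0 ≤ C * ε)
    (hboot : ∀ t ∈ Icc 0 T, f t ≤ 4 * C * ε → f t ≤ C * ε + C * K * f t ^ 2) :
    ∀ t ∈ Icc 0 T, f t ≤ 2 * C * ε := by
  have hC0 : 0 < C := by linarith
  have hCε : 0 < C * ε := by positivity
  have h16 : 16 * C ^ 2 * K * ε ≤ 1 := by
    have hpos : 0 < 16 * C ^ 2 * K := by positivity
    calc 16 * C ^ 2 * K * ε ≤ 16 * C ^ 2 * K * (1 / (16 * C ^ 2 * K)) := by gcongr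
      _ = 1 := by field_simp
  have key : ∀ t ∈ Icc 0 T, f t < 4 * C * ε → f t ≤ 2 * C * ε := by
    intro t ht hlt
    have hb := hboot t ht hlt.le
    rcases le_or_gt (f t) 0 with hneg | hpos
    · linarith
    · have hsq : f t ^ 2 ≤ (4 * C * ε) * f t := by nlinarith
      have hCK : 0 ≤ C * K := by positivity
      have h1 : f t ≤ C * ε + C * K * ((4 * C * ε) * f t) := by
        nlinarith [mul_le_mul_of_nonneg_left hsq hCK]
      have hq : C * K * (4 * C * ε) ≤ 1 / 4 := by nlinarith
      have h2 : C * K * ((4 * C * ε) * f t) ≤ (1 / 4) * f t := by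
        have := mul_le_mul_of_nonneg_right hq hpos.le
        linarith [this]
      linarith
  set s : Set ℝ := {t | t ∈ Icc 0 T → f t ≤ 2 * C * ε} with hs
  have hsub : Icc 0 T ⊆ s := by
    apply IsClosed.Icc_subset_of_forall_mem_nhdsWithin
    · have : s ∩ Icc 0 T = Icc 0 T ∩ f ⁻¹' Iic (2 * C * ε) := by
        ext t
        simp only [hs, mem_inter_iff, mem_setOf_eq, mem_preimage, mem_Iic]
        tauto
      rw [this]
      exact hf.preimage_isClosed_of_isClosed isClosed_Icc isClosed_Iic
    · intro _
      linarith
    · rintro x ⟨hx, hxI⟩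
      have hxT : x ∈ Icc 0 T := ⟨hxI.1, hxI.2.le⟩
      have hfx : f x ≤ 2 * C * ε := hx hxT
      have hcont : ContinuousWithinAt f (Icc 0 T) x := hf x hxT
      have hev : ∀ᶠ t in 𝓝[Icc 0 T] x, f t < 4 * C * ε :=
        hcont.tendsto.eventually_lt_const (by linarith)
      obtain ⟨u, hu, hsub'⟩ := mem_nhdsWithin_iff_exists_mem_nhds_inter.mp hev
      apply mem_nhdsWithin_of_mem_nhds
      apply Filter.mem_of_superset hu
      intro t ht htI
      exact key t htI (hsub' ⟨ht, htI⟩)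
  exact fun t ht ↦ hsub ht ht

/-- **Tameness, first instance: the superradiant non-trapping margin is exactly linear in `χ`.**
For `0 ≤ a < M`, an admissible triple and a superradiant frequency `mω ≤ a m²/(2 M r₊)`,
`dV₀/dr(r₊) ≥ χ Λ/(8 M³)`, `χ = 1 − (a/M)²`: the tree's DRSR Lemma 6.4.1 bound
`4 (r₊ − M)(M r₊ − a²) Λ/(r₊² + a²)³` (`Kerr.le_deriv_sepPotential₀_rPlus`) with the identities
`(r₊ − M)(M r₊ − a²) = r₊ (M² − a²)`, `r₊² + a² = 2 M r₊`, `r₊ ≤ 2M`. A semialgebraic margin dies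
polynomially (Łojasiewicz); here the exponent is `1`. -/
theorem firstLemma_superradiantMargin_linear {M a ω Λ : ℝ} {m : ℤ} (hM : 0 < M) (ha0 : 0 ≤ a)
    (haM : a < M) (hadm : Kerr.IsAdmissibleTriple a ω m Λ)
    (hsr : m * ω ≤ a * (m : ℝ) ^ 2 / (2 * M * Kerr.rPlus M a)) :
    (1 - (a / M) ^ 2) * Λ / (8 * M ^ 3) ≤
      deriv (Kerr.sepPotential₀ M a ω m Λ) (Kerr.rPlus M a) := by
  refine le_trans ?_ (Kerr.le_deriv_sepPotential₀_rPlus hM ha0 haM hadm hsr)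
  have habs : |a| ≤ M := by rw [abs_of_nonneg ha0]; exact haM.le
  have hΛ : 0 ≤ Λ := hadm.nonneg
  set q := √(M ^ 2 - a ^ 2) with hq
  have hq0 : 0 ≤ q := Real.sqrt_nonneg _
  have hpos : 0 ≤ M ^ 2 - a ^ 2 := by nlinarith
  have hq2 : q ^ 2 = M ^ 2 - a ^ 2 := by
    rw [hq, Real.sq_sqrt hpos]
  have hrp : Kerr.rPlus M a = M + q := rfl
  have hqM : q ≤ M := by
    rw [hq]
    calc √(M ^ 2 - a ^ 2) ≤ √(M ^ 2) := Real.sqrt_le_sqrt (by nlinarith)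
      _ = M := Real.sqrt_sq hM.le
  have hr0 : 0 < M + q := by linarith
  -- identities
  have hid1 : (Kerr.rPlus M a - M) * (M * Kerr.rPlus M a - a ^ 2) = q ^ 2 * (M + q) := by
    rw [hrp]; nlinarith [hq2]
  have hid2 : Kerr.rPlus M a ^ 2 + a ^ 2 = 2 * M * (M + q) := by
    rw [hrp]; nlinarith [hq2]
  have hχ : 1 - (a / M) ^ 2 = q ^ 2 / M ^ 2 := by
    rw [hq2]; field_simp
  rw [show 4 * (Kerr.rPlus M a - M) * (M * Kerr.rPlus M a - a ^ 2) * Λ =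
      4 * ((Kerr.rPlus M a - M) * (M * Kerr.rPlus M a - a ^ 2)) * Λ by ring, hid1, hid2, hχ]
  -- goal: q²/M² * Λ / (8 M³) ≤ 4 (q² (M+q)) Λ / (2M(M+q))³
  rw [div_mul_eq_mul_div, div_div, div_le_div_iff₀ (by positivity) (by positivity)]
  -- q² Λ (2M(M+q))³ ≤ 4 q² (M+q) Λ (M² (8 M³))
  have hkey : (M + q) ^ 2 ≤ 4 * M ^ 2 := by nlinarith
  have hbase : 0 ≤ 8 * M ^ 3 * (q ^ 2 * Λ * (M + q)) := by positivity
  calc q ^ 2 * Λ * (2 * M * (M + q)) ^ 3 = 8 * M ^ 3 * (q ^ 2 * Λ * (M + q)) * (M + q) ^ 2 := by ring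
    _ ≤ 8 * M ^ 3 * (q ^ 2 * Λ * (M + q)) * (4 * M ^ 2) := mul_le_mul_of_nonneg_left hkey hbase
    _ = 4 * (q ^ 2 * (M + q)) * Λ * (M ^ 2 * (8 * M ^ 3)) := by ring

/-- The crux, by name (the lines above are levers towards it; no skeleton at this stage). -/
example : Prop := Summit.FinalStateConjecture.FinalStateConjecture.Theses.PhaseMixingCapture.NearExtremalKappaCapture

end Summit.FinalStateConjecture.FinalStateConjecture.Cruxes.NearExtremalKappaCapture.Ideator1
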